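import Summits.QuantumFields.YangMills.Theorems.BalabanUVNodesPortS1P0CMobiusInt

/-!
# NODE O port — `stub_P0C` (the guarded P0-ℂ letter `P0HolExtAtRecordGL`), brick F: THE SUPPLIER INTERFACE — `P0CarrierClauses` FROM AN X-INDEXED FAMILY OF LOCALIZED KERNELS
# (memo `Cruxes/PortRecordRepresentationS1/Lines/pta_residueW-stub_P0C-hand.md` §3 R7, §4 (M1)–(M6); over ✓`…PortS1P0CMobius` (torus pieces) and ✓`…PortS1P0CMobiusInt` (integer pieces))

Porter hand `hand-27930-P0C` (g0), `--supports stmt-QuantumFields-27930 --as helper`; count-neutral.  [I] = [Balaban1987RG1], [15] = [Balaban1985Variational], [B9] = [Balaban1985BackgroundPropagators],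
[16] = [Balaban1985UV3].

WHAT.  ONE theorem, ★ `p0CarrierClauses_of_family`: the body `P0CarrierClauses F a₀ δ₀ c₀ γ₀ γ₁ Mc α₀ α₁ ε₂₉ k TC TY TZY AdM AdZ` of `stub_P0C`'s letter HOLDS for the carriers
  `TC n := T n X_full` (the whole-torus member of the family), `TY n := p0cPiece … (T n)` (the Möbius pieces over `(𝐃_{k+1}(T_K), ⊆)`), `TZY := p0cIntPiece TZ` (the integer Möbius pieces, `0` off the
  non-empty face-connected sets),
as soon as the supplier provides a torus family `T n : 𝐃 → (pairs → level-k bond kernels)` and an integer family `TZ : (non-empty face-connected X̂ ⊆ ℤ⁴) → (IntBondCfg → kernels)` with: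
(Z-supp)∕(Z-loc)∕(Z-cov) FOR THE FAMILY `TZ` · the (Z-bridge) FOR THE PIECES (the cover-kit row, left to the supplier) · (P2) the germ identity FOR `T n X_full` · (P3) covariance FOR THE FAMILY ·
(P4-b)(P4-c)(P4-d) support ∕ (1.7)-locality ∕ analyticity on the record space FOR THE FAMILY · (P4-e) Schur decay FOR THE PIECES (the genuine estimate, [16] (23)–(25)) · (P5) verbatim
(carrier-free) · (P5ᶜ) complex coercivity FOR THE FAMILY (`Re T_X ≥ γ₀` on X-supported vectors, [15] Thm 1 (E2)).  (P4-a) and (Z-dom) cost nothing (✓`sum_p0cPiece_univ`, ✓`p0cIntPiece_of_not`);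
(P5ᶜ)'s inner sum is rewritten by ✓`sum_p0cPiece_subset`.  This is the memo's supplier road (M1)–(M6) as ONE kernel-checked reduction: what remains GENUINE is the construction of the
X-localized holomorphic (2.11) operators `T_X` ([I] p.267–268, [B9] §A–§B), their analyticity radii, the decay of their Möbius pieces, (E2), the germ identity and the integer twin's bridge.

HONEST FRAMING.  A reduction (bookkeeping over the two Möbius files); NO estimate; nothing of Bałaban asserted, ported or discharged; the hypotheses are inhabited NOWHERE today; `stub_P0C`
NOT closed; ⟨27930⟩ OPEN; NODE O 0∕1; COUNT 8∕28 · K 1∕4 UNMOVED; finite `𝕋⁴_{L^K}` at fixed ε — NOT continuum ∕ OS ∕ Clay; **the Yang–Mills mass gap is NOT proved by any of this.**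
No `sorry`, no `instance`, no `notation`, no `def`; standard axioms.
-/

noncomputable section

open scoped BigOperators Matrix.Norms.L2Operator Topology
open Filter Finset

namespace Summit.QuantumFields.YangMills.Theorems.BalabanUVNodesPortS1

open Summit.QuantumFields.YangMills.Theorems.K0RecordFormatNames
open Literature.MathematicalPhysics.QuantumFieldTheory.Balaban1983to89
open Literature.MathematicalPhysics.QuantumFieldTheory.Balaban1983to89.Node00
open Literature.MathematicalPhysics.QuantumFieldTheory.Balaban1983to89.T4Continuum (T4Family)
open Literature.MathematicalPhysics.QuantumLattice (blockMap)

variable (F : T4Family)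

/-- ★ **THE SUPPLIER INTERFACE**: `P0CarrierClauses` for `(TC, TY, TZY) := (T · X_full, Möbius pieces of T, integer Möbius pieces of TZ)` from family-level hypotheses (and the piece-level
decay + bridge rows).  See the module docstring for the dictionary to (P1)–(P5ᶜ). [cite: Balaban1987RG1, (1.7) p.261, (1.10) p.262, (1.19) p.263, (1.21) p.264, (2.11) p.267;
Balaban1985Variational, Prop. 9 p.309, Thm 1 p.279; Balaban1985UV3, (23) p.262] -/
theorem p0CarrierClauses_of_family (a₀ δ₀ c₀ γ₀ γ₁ : ℝ) (Mc : ℕ) (α₀ α₁ ε₂₉ : ℝ) (k : ℕ)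
    (T : (n : ℕ) → (recordDomSys F Mc k (recordK₀ F Mc k + n)).Dom → Sect2.CPair (F.P (recordK₀ F Mc k + n)) (MatA 2) →
        FluctIdx F k (recordK₀ F Mc k + n) → FluctIdx F k (recordK₀ F Mc k + n) → ℂ)
    (TZ : P0CIntDom → IntBondCfg → P0CIntIdx → P0CIntIdx → ℂ)
    (AdM : (n : ℕ) → (Site (F.P (recordK₀ F Mc k + n)) 0 → (MatA 2)ˣ) →
        Matrix (FluctIdx F k (recordK₀ F Mc k + n)) (FluctIdx F k (recordK₀ F Mc k + n)) ℂ)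
    (AdZ : ((Fin 4 → ℤ) → (MatA 2)ˣ) → (Fin 4 → ℤ) × Fin 4 → Matrix (Fin 3) (Fin 3) ℂ)
    -- (Z-supp) for the integer family
    (hZsupp : ∀ (X : P0CIntDom) (f : IntBondCfg) (bi bj : (Fin 4 → ℤ) × Fin 4) (a a' : Fin 3),
      (blockMap (F.L * Mc) bi.1 ∉ X.1 ∨ blockMap (F.L * Mc) bj.1 ∉ X.1) → TZ X f (bi, a) (bj, a') = 0)
    -- (Z-loc) for the integer family
    (hZloc : ∀ (X : P0CIntDom) (f f' : IntBondCfg),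
      (∀ zμ : (Fin 4 → ℤ) × Fin 4, zμ.1 ∈ (⋃ a ∈ X.1, B14.Eq213MaximalDomains.cubeExt (F.L ^ (k + 1) * Mc) a 0) →
        Function.update zμ.1 zμ.2 (zμ.1 zμ.2 + 1) ∈ (⋃ a ∈ X.1, B14.Eq213MaximalDomains.cubeExt (F.L ^ (k + 1) * Mc) a 0) → f zμ = f' zμ) → TZ X f = TZ X f')
    -- (Z-cov) for the integer family
    (hZcov : ∀ û : (Fin 4 → ℤ) → (MatA 2)ˣ, (∀ z, û z ∈ (B12RegularSpaces111SpecialUnitary.suModel 2).Gc) →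
      (∀ b : (Fin 4 → ℤ) × Fin 4, IsUnit (AdZ û b)) ∧
      ∀ (X : P0CIntDom) (f : IntBondCfg) (bi bj : (Fin 4 → ℤ) × Fin 4),
        (Matrix.of fun a a' : Fin 3 => TZ X (intGaugeAct û f) (bi, a) (bj, a')) =
          AdZ û bi * (Matrix.of fun a a' : Fin 3 => TZ X f (bi, a) (bj, a')) * (AdZ û bj)⁻¹)
    -- (Z-bridge) for the PIECES (the cover-kit row)
    (hbridge : ∀ (n : ℕ) (Y : (recordDomSys F Mc k (recordK₀ F Mc k + n)).Dom), Y ∉ recordWrapCtr F Mc k (recordK₀ F Mc k + n) →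
      ∀ (φ : Sect2.CPair (F.P (recordK₀ F Mc k + n)) (MatA 2)) (bi bj : (Fin 4 → ℤ) × Fin 4) (a a' : Fin 3),
        blockMap (F.L * Mc) bi.1 ∈ intCubes F Mc k (recordK₀ F Mc k + n) Y → blockMap (F.L * Mc) bj.1 ∈ intCubes F Mc k (recordK₀ F Mc k + n) Y →
        p0cPiece F Mc k (recordK₀ F Mc k + n) (T n) Y φ (coverBondAt (F.P (recordK₀ F Mc k + n)) k bi, a) (coverBondAt (F.P (recordK₀ F Mc k + n)) k bj, a') =
          p0cIntPiece TZ (intCubes F Mc k (recordK₀ F Mc k + n) Y) (pullPair F (recordK₀ F Mc k + n) φ) (bi, a) (bj, a'))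
    -- (P2) germ identity for the whole-torus member
    (hP2 : letI θ := thetaFill F a₀ ε₂₉; letI := θ.instVβ₁; letI := θ.instVβ₂; letI := θ.instιβ
      ∀ n : ℕ, ∀ᶠ B in 𝓝 (0 : recordW F a₀ ε₂₉ k (recordK₀ F Mc k + n)),
        ∀ i j : NonB0Idx F k (recordK₀ F Mc k + n),
          T n (g3cFull F Mc k (recordK₀ F Mc k + n)) (recordPairJ F θ k (recordK₀ F Mc k + n) B) i.1 j.1 =
            ((recordPreckLoc F k (recordK₀ F Mc k + n) a₀ (portVkAx F a₀ ε₂₉ k (recordK₀ F Mc k + n) B)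
              (hopLinGraph F k (recordK₀ F Mc k + n) (portVkAx F a₀ ε₂₉ k (recordK₀ F Mc k + n) B)) i j : ℝ) : ℂ))
    -- (P3) covariance for the family
    (hP3 : ∀ (n : ℕ) (u : Site (F.P (recordK₀ F Mc k + n)) 0 → (MatA 2)ˣ),
      IsUnit (AdM n u) ∧ (∀ i j : FluctIdx F k (recordK₀ F Mc k + n), i.1 ≠ j.1 → AdM n u i j = 0) ∧
      ∀ (X : (recordDomSys F Mc k (recordK₀ F Mc k + n)).Dom) (φ : Sect2.CPair (F.P (recordK₀ F Mc k + n)) (MatA 2)),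
        Matrix.of (T n X (Sect2.cAct u φ)) = AdM n u * Matrix.of (T n X φ) * (AdM n u)⁻¹)
    -- (P4-b) support for the family
    (hsupp : ∀ (n : ℕ) (X : (recordDomSys F Mc k (recordK₀ F Mc k + n)).Dom) (φ : Sect2.CPair (F.P (recordK₀ F Mc k + n)) (MatA 2))
        (i j : FluctIdx F k (recordK₀ F Mc k + n)),
      (B15DeterminingSets.embIter k i.1.src ∉ Sect2.domSites (F.P (recordK₀ F Mc k + n)) Mc (k + 1) X ∨
        B15DeterminingSets.embIter k j.1.src ∉ Sect2.domSites (F.P (recordK₀ F Mc k + n)) Mc (k + 1) X) → T n X φ i j = 0)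
    -- (P4-c) (1.7)-locality for the family
    (hloc : ∀ (n : ℕ) (X : (recordDomSys F Mc k (recordK₀ F Mc k + n)).Dom) (φ ψ : Sect2.CPair (F.P (recordK₀ F Mc k + n)) (MatA 2)),
      Sect2.agreeOnSet (Sect2.domSites (F.P (recordK₀ F Mc k + n)) Mc (k + 1) X) φ ψ → T n X φ = T n X ψ)
    -- (P4-d) analyticity on the record space for the family
    (han : ∀ (n : ℕ) (X : (recordDomSys F Mc k (recordK₀ F Mc k + n)).Dom) (φ : Sect2.CPair (F.P (recordK₀ F Mc k + n)) (MatA 2)),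
      encodeCfg F (recordK₀ F Mc k + n) φ ∈ recordUc F Mc k α₀ α₁ (recordK₀ F Mc k + n) X →
        ∀ i j : FluctIdx F k (recordK₀ F Mc k + n), AnalyticAt ℂ (fun ψ : Sect2.CPair (F.P (recordK₀ F Mc k + n)) (MatA 2) => T n X ψ i j) φ)
    -- (P4-e) Schur decay for the PIECES (the estimate)
    (hdecay : ∀ (n : ℕ) (Y : (recordDomSys F Mc k (recordK₀ F Mc k + n)).Dom) (φ : Sect2.CPair (F.P (recordK₀ F Mc k + n)) (MatA 2)),
      encodeCfg F (recordK₀ F Mc k + n) φ ∈ recordUc F Mc k α₀ α₁ (recordK₀ F Mc k + n) Y →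
        (∀ i : FluctIdx F k (recordK₀ F Mc k + n),
          ∑ j : FluctIdx F k (recordK₀ F Mc k + n), ‖p0cPiece F Mc k (recordK₀ F Mc k + n) (T n) Y φ i j‖ ≤
            c₀ * Real.exp (-(δ₀ * (recordDomSys F Mc k (recordK₀ F Mc k + n)).dj Y))) ∧
        (∀ j : FluctIdx F k (recordK₀ F Mc k + n),
          ∑ i : FluctIdx F k (recordK₀ F Mc k + n), ‖p0cPiece F Mc k (recordK₀ F Mc k + n) (T n) Y φ i j‖ ≤
            c₀ * Real.exp (-(δ₀ * (recordDomSys F Mc k (recordK₀ F Mc k + n)).dj Y))))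
    -- (P5) verbatim (carrier-free)
    (hP5 : letI θ := thetaFill F a₀ ε₂₉; letI := θ.instVβ₁; letI := θ.instVβ₂; letI := θ.instιβ
      ∀ n : ℕ, ∀ᶠ B in 𝓝 (0 : recordW F a₀ ε₂₉ k (recordK₀ F Mc k + n)),
        (recordPreckLoc F k (recordK₀ F Mc k + n) a₀ (portVkAx F a₀ ε₂₉ k (recordK₀ F Mc k + n) B)
            (hopLinGraph F k (recordK₀ F Mc k + n) (portVkAx F a₀ ε₂₉ k (recordK₀ F Mc k + n) B))).PosDef ∧
        ∀ v : NonB0Idx F k (recordK₀ F Mc k + n) → ℝ,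
          γ₀ * dotProduct v v ≤
              dotProduct v (Matrix.mulVec (recordPreckLoc F k (recordK₀ F Mc k + n) a₀ (portVkAx F a₀ ε₂₉ k (recordK₀ F Mc k + n) B)
                (hopLinGraph F k (recordK₀ F Mc k + n) (portVkAx F a₀ ε₂₉ k (recordK₀ F Mc k + n) B))) v) ∧
            dotProduct v (Matrix.mulVec (recordPreckLoc F k (recordK₀ F Mc k + n) a₀ (portVkAx F a₀ ε₂₉ k (recordK₀ F Mc k + n) B)
                (hopLinGraph F k (recordK₀ F Mc k + n) (portVkAx F a₀ ε₂₉ k (recordK₀ F Mc k + n) B))) v) ≤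
              γ₁ * dotProduct v v)
    -- (P5ᶜ) complex coercivity for the family
    (hcoer : ∀ (n : ℕ) (X : (recordDomSys F Mc k (recordK₀ F Mc k + n)).Dom) (φ : Sect2.CPair (F.P (recordK₀ F Mc k + n)) (MatA 2)),
      encodeCfg F (recordK₀ F Mc k + n) φ ∈ recordUc F Mc k α₀ α₁ (recordK₀ F Mc k + n) X →
        ∀ v : NonB0Idx F k (recordK₀ F Mc k + n) → ℂ,
          (∀ i : NonB0Idx F k (recordK₀ F Mc k + n),
            B15DeterminingSets.embIter k i.1.1.src ∉ Sect2.domSites (F.P (recordK₀ F Mc k + n)) Mc (k + 1) X → v i = 0) →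
          γ₀ * (∑ i, ‖v i‖ ^ 2) ≤ (∑ i, ∑ j, star (v i) * T n X φ i.1 j.1 * v j).re) :
    P0CarrierClauses F a₀ δ₀ c₀ γ₀ γ₁ Mc α₀ α₁ ε₂₉ k
      (fun n => T n (g3cFull F Mc k (recordK₀ F Mc k + n)))
      (fun n => p0cPiece F Mc k (recordK₀ F Mc k + n) (T n))
      (p0cIntPiece TZ) AdM AdZ := by
  refine ⟨?_, ?_, ?_, ?_, hbridge, hP2, ?_, ?_, ?_, ?_, ?_, hP5, ?_⟩
  -- (Z-supp)
  · intro Xh f bi bj a a' h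
    exact p0cIntPiece_support TZ (F.L * Mc) hZsupp Xh f bi bj a a' h
  -- (Z-dom)
  · intro Xh f i j h
    exact p0cIntPiece_of_not TZ h f i j
  -- (Z-loc)
  · intro i j
    exact p0cIntPiece_isLocal TZ (F.L ^ (k + 1) * Mc) hZloc i j
  -- (Z-cov)
  · intro û hû
    exact ⟨(hZcov û hû).1, fun Xh f bi bj => p0cIntPiece_cov TZ AdZ (fun û' hû' X f' bi' bj' => (hZcov û' hû').2 X f' bi' bj') û hû Xh f bi bj⟩
  -- (P3)
  · intro n u
    exact ⟨(hP3 n u).1, (hP3 n u).2.1, fun Y φ => p0cPiece_cAct (T n) (AdM n) (fun X u' ψ => (hP3 n u').2.2 X ψ) Y u φ⟩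
  -- (P4-a)
  · intro n φ i j
    exact (sum_p0cPiece_univ (T n) φ i j).symm
  -- (P4-b)
  · intro n Y φ i j h
    exact p0cPiece_support (T n) (hsupp n) Y φ i j h
  -- (P4-c)
  · intro n Y φ ψ h
    exact p0cPiece_local (T n) (hloc n) Y φ ψ h
  -- (P4-d) ∧ (P4-e)
  · intro n Y φ hφ
    exact ⟨fun i j => p0cPiece_analyticAt (T n) (han n) Y φ hφ i j, (hdecay n Y φ hφ).1, (hdecay n Y φ hφ).2⟩
  -- (P5ᶜ)
  · intro n X φ hφ v hv
    simp only [sum_p0cPiece_subset]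
    exact hcoer n X φ hφ v hv

end Summit.QuantumFields.YangMills.Theorems.BalabanUVNodesPortS1

end
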